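import Summits.AtomisticToContinuum.Crystallization.Theorems.FrustratedLawDichotomyAperiodicGapRecordJunctionHost
import Summits.AtomisticToContinuum.Crystallization.Theorems.FrustratedLawDichotomyStrainedPatchTailPacking
import HarnessLib

/-!
# FrustratedLawDichotomy · crux `AperiodicFrustratedLawGap` (stmt-AtomisticToContinuum-27623) — RECORD JUNCTION, TAIL-CERTIFICATE FORM (R1″ of record)
# (decomp-a2c, prover hand 2, generation 33; structural share, sequel of `…AperiodicGapRecordJunctionHost`)

`…RecordJunctionHost` removed (TF) as a binder in favour of the host tables, keeping the cluster-quantified far column `FarColumn 𝓘 τ r X`.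
lens-5 g73 parts 4/5 (`…StrainedPatchFarSplit`, `…StrainedPatchTailPacking`; critic row 1216: «R1″ OF RECORD for 27623 T-leaf :=
coreOff_of_envelope_tailCert — no cluster-quantified far/tail binder left») split the far column into the PER-HOST far table (HFAR) `HostFarTab 𝓘 τ r Xh`
and the PER-HOST-ROW tail certificate (TAILCERT) `TailCert 𝓘 τ Xe` (decidable real arithmetic, no cluster quantifier), with the per-bond law in CLOSED FORM
(`cubicTail (s ↦ gammaMaj (s − 2τ))`, no γ-table) or with a census γ-table `L`.

This DEF-FREE module threads R1″ to the crux: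
* §1 `strainedPatchRec_of_homFloor_625_of_envelope_tailCert` / `…_of_gammaTable_tailCert`;
* §2 the crux BY NAME `aperiodicFrustratedLawGap_of_entryTrees_of_envelope_tailCert` (+ periodic sibling 27624), `…_of_entryTrees_of_gammaTable_tailCert`,
  and `aperiodicFrustratedLawGap_of_entryTreesCR_of_envelope_tailCert` (hand 1's centred-rotated hcp verdict `entryLeafOKHT5QDCRX`);
* §3 sanity at the cell width of record `τ = 1/100`: the side conditions read `1/50 < s₀` and `r ≤ 349/50`.

STATUS (critic row 1230, 2026-09-02T16:29Z): R1″ is SOUND but UNINSTANTIABLE-AS-TYPED — (HTOP)/(HSTEP) bound the price at every `HostMaybeReach` row, and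
rim rows have certified box price ≥ 20.3 σ₁, so `hs` and `hC` cannot both be met; the endorsed repair (lens-5 g74 JOB 1, «rim-fold»: a row radius `R_X` in
(HTOP)/(HSTEP)/(SV)-glue, rim rows carried by the crude tail inside `X`) re-proves `coreOff_of_envelope_hostFarTab` in that form and plugs into §1 below by a
one-line sibling.  Until then this module records the T-side junction AS A SHAPE; the instantiable generic shape is
`…RecordJunctionHost.aperiodicFrustratedLawGap_of_entryTrees_of_pricedDescent` (any priced charge `Φ`, slack column `X`: the rim-fold is a choice of `(Φ, X)`).

T-SIDE BINDER CENSUS after this file (every binder family-level, per-host or per-host-row; none cluster-quantified): FamilyCover 𝓘 (24/5) (1/100) (1/8) τ ·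
HostSep 𝓘 s₀ · HostFarTab 𝓘 τ r Xh · TailCert 𝓘 τ Xe · column domination Xh + Xe ≤ X · HostTop · HostStep-table · SlackCert (+ the numeric side conditions
0 ≤ τ, 2τ < s₀, r + 2τ ≤ 7).  One-line compositions of tree theorems; 0 sorry; no definitions; standard axioms.  `--supports stmt-AtomisticToContinuum-27623`.
[folklore instantiation]
-/

noncomputable section

namespace Summit.AtomisticToContinuum.Crystallization.Theorems.FrustratedLawDichotomyAperiodicGapRecordJunctionTail

open Summit.AtomisticToContinuum.Crystallization.Theorems.ChargedEnergyGapNegative (eStar E3)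
open Summit.AtomisticToContinuum.Crystallization.Theorems.FrustratedLawDichotomyRangeCut
open Summit.AtomisticToContinuum.Crystallization.Theorems.FrustratedLawDichotomySchurCut
open Summit.AtomisticToContinuum.Crystallization.Theorems.FrustratedLawDichotomyMotifLemmas (GoodAtScale)
open Summit.AtomisticToContinuum.Crystallization.Theorems.FrustratedLawDichotomyExemptLocOpt (LocOptFails)
open Summit.AtomisticToContinuum.Crystallization.Theorems.FrustratedLawDichotomyExemptSplit (SchurElasticPricingX)
open Summit.AtomisticToContinuum.Crystallization.Theorems.FrustratedLawDichotomyExemptAbsorptionRecord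
open Summit.AtomisticToContinuum.Crystallization.Theorems.FrustratedLawDichotomyCollarCensus
open Summit.AtomisticToContinuum.Crystallization.Theorems.FrustratedLawDichotomyCollarCensusKappa
open Summit.AtomisticToContinuum.Crystallization.Theorems.FrustratedLawDichotomyStrainedPatchHomSplit
open Summit.AtomisticToContinuum.Crystallization.Theorems.FrustratedLawDichotomyStrainedPatchCleanCollar (TailPenalty AnnularDefectFloor DefectiveCollarFloor)
open Summit.AtomisticToContinuum.Crystallization.Theorems.FrustratedLawDichotomyStrainedPatchPhaseCut (AnnularPhaseFloor PolyTextureFloor)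
open Summit.AtomisticToContinuum.Crystallization.Theorems.FrustratedLawDichotomyStrainedPatchCoreTube (CoreOffTubeFloor)
open Summit.AtomisticToContinuum.Crystallization.Theorems.FrustratedLawDichotomyStrainedPatchCoreTubeRecord (CoreCoreRelief seam_arith_core
  strainedPatchRec_of_homFloor_of_tailPenalty_of_coreRelief_of_coreOff_of_annularPhase_of_poly_of_annular_of_near)
open Summit.AtomisticToContinuum.Crystallization.Theorems.FrustratedLawDichotomyStrainedPatchHostCells (FamP FamilyCover)
open Summit.AtomisticToContinuum.Crystallization.Theorems.FrustratedLawDichotomyStrainedPatchHomCertTree (CertTree treeOK)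
open Summit.AtomisticToContinuum.Crystallization.Theorems.FrustratedLawDichotomyStrainedPatchHomEntryGram (rootC rootW)
open Summit.AtomisticToContinuum.Crystallization.Theorems.FrustratedLawDichotomyStrainedPatchHomEntryGramHcp (rootCH rootWH)
open Summit.AtomisticToContinuum.Crystallization.Theorems.FrustratedLawDichotomyStrainedPatchHomEntryTable (muRec)
open Summit.AtomisticToContinuum.Crystallization.Theorems.FrustratedLawDichotomyStrainedPatchHomEntryTableP (entryLeafOK6RBKP)
open Summit.AtomisticToContinuum.Crystallization.Theorems.FrustratedLawDichotomyStrainedPatchHomEntryLeafHT (HTCert entryLeafOKHT5QDMX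
  homFloor_625_of_entryTrees6RBKP_HT5QDMX entryLeafOKHT5QDCRX homFloor_625_of_entryTrees6RBKP_HT5QDCRX)
open Summit.AtomisticToContinuum.Crystallization.Theorems.FrustratedLawDichotomyStrainedPatchQuantSlaving (ChartFam HessTab ForceTab SlackTab hessBlk0 force0)
open Summit.AtomisticToContinuum.Crystallization.Theorems.FrustratedLawDichotomyStrainedPatchSVCharge (SlackCert)
open Summit.AtomisticToContinuum.Crystallization.Theorems.FrustratedLawDichotomyStrainedPatchTaylorCharge (HostSep cubicTail)
open Summit.AtomisticToContinuum.Crystallization.Theorems.FrustratedLawDichotomyStrainedPatchHostStep (HostTop HostStep)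
open Summit.AtomisticToContinuum.Crystallization.Theorems.FrustratedLawDichotomyStrainedPatchBondCalculus (bondD3 bondGamma)
open Summit.AtomisticToContinuum.Crystallization.Theorems.FrustratedLawDichotomyStrainedPatchFarSplit (HostFarTab gammaMaj)
open Summit.AtomisticToContinuum.Crystallization.Theorems.FrustratedLawDichotomyStrainedPatchTailPacking (TailCert coreOff_of_envelope_tailCert
  coreOff_of_gammaTable_tailCert)
open Summit.AtomisticToContinuum.Crystallization.Theorems.FrustratedLawDichotomyAperiodicGapRecordJunction

/-! ## §1 `StrainedPatchRec` from R1″ -/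

/-- ★★★ **R1″ ⟹ StrainedPatchRec (envelope form)**: `HomFloor (1/625) ∧ TailPenalty (24/5) (1/1000) ∧ CoreCoreRelief … (3/5000) ∧ FamilyCover 𝓘 (24/5) (1/100) (1/8) τ ∧
2τ < s₀ ∧ HostSep 𝓘 s₀ ∧ r + 2τ ≤ 7 ∧ HostFarTab 𝓘 τ r Xh ∧ TailCert 𝓘 τ Xe ∧ (Xh + Xe ≤ X) ∧ HostTop/HostStep-table with the closed-form tail
`cubicTail (s ↦ gammaMaj (s − 2τ))` ∧ SlackCert … (k n) ∧ AnnularPhaseFloor ∧ PolyTextureFloor ∧ AnnularDefectFloor ∧ DefectiveCollarFloor ⟹ StrainedPatchRec`.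
[folklore instantiation: `…CoreTubeRecord.strainedPatchRec_of_homFloor_of_…` with `hC := …TailPacking.coreOff_of_envelope_tailCert`] -/
theorem strainedPatchRec_of_homFloor_625_of_envelope_tailCert {𝓘 : ChartFam} {τ s₀ r : ℝ} {X Xh Xe : SlackTab} (k : ℕ → ℝ) (n : ℕ) (hτ : 0 ≤ τ)
    (hHF : HomFloor (1 / 625)) (hT : TailPenalty (24 / 5) (1 / 1000)) (hRl : CoreCoreRelief (63 / 10) (63 / 10) (24 / 5) (1 / 100) (3 / 5000))
    (hFC : FamilyCover 𝓘 (24 / 5) (1 / 100) (1 / 8) τ) (hτs : 2 * τ < s₀) (hsep : HostSep 𝓘 s₀) (hr7 : r + 2 * τ ≤ 7)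
    (hH : HostFarTab 𝓘 τ r Xh) (hTC : TailCert 𝓘 τ Xe)
    (hdom : ∀ (M₀ : ℕ) (z₀ : Fin M₀ → E3) (c₀ h : Fin M₀), Xh M₀ z₀ c₀ h + Xe M₀ z₀ c₀ h ≤ X M₀ z₀ c₀ h)
    (h0 : HostTop 𝓘 τ bondD3 (cubicTail fun s => gammaMaj (s - 2 * τ)) r (k 0 * sigmaOne))
    (hs : ∀ i : ℕ, i < n → HostStep 𝓘 τ sigmaOne bondD3 (cubicTail fun s => gammaMaj (s - 2 * τ)) r hessBlk0 force0 X (k i) (k (i + 1) * sigmaOne))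
    (hC : SlackCert 𝓘 τ (k n) sigmaOne hessBlk0 force0 X)
    (hF : AnnularPhaseFloor (63 / 10) (24 / 5) (63 / 10) (1 / 1000)) (hP : PolyTextureFloor (63 / 10) (24 / 5) (1 / 1000))
    (hA : AnnularDefectFloor (24 / 5) (63 / 10)) (hD : DefectiveCollarFloor (24 / 5)) : StrainedPatchRec :=
  strainedPatchRec_of_homFloor_of_tailPenalty_of_coreRelief_of_coreOff_of_annularPhase_of_poly_of_annular_of_near (by norm_num) hHF hT hRl
    seam_arith_core (coreOff_of_envelope_tailCert k n hτ hFC hτs hsep hr7 hH hTC hdom h0 hs hC) hF hP le_rfl (by norm_num) (by norm_num) hA hD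

/-- ★★★ **R1″ ⟹ StrainedPatchRec (census γ-table form)**: the same with a γ-table `bondGamma ≤ L` on the `2τ`-bands and the tail `cubicTail L`.
[folklore instantiation: `hC := …TailPacking.coreOff_of_gammaTable_tailCert`] -/
theorem strainedPatchRec_of_homFloor_625_of_gammaTable_tailCert {𝓘 : ChartFam} {τ s₀ r : ℝ} {L : ℝ → ℝ} {X Xh Xe : SlackTab} (k : ℕ → ℝ) (n : ℕ)
    (hτ : 0 ≤ τ)
    (hHF : HomFloor (1 / 625)) (hT : TailPenalty (24 / 5) (1 / 1000)) (hRl : CoreCoreRelief (63 / 10) (63 / 10) (24 / 5) (1 / 100) (3 / 5000))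
    (hFC : FamilyCover 𝓘 (24 / 5) (1 / 100) (1 / 8) τ) (hτs : 2 * τ < s₀)
    (hL : ∀ s : ℝ, s₀ ≤ s → s < r → ∀ s' : ℝ, |s' - s| ≤ 2 * τ → bondGamma s' ≤ L s) (hsep : HostSep 𝓘 s₀) (hr7 : r + 2 * τ ≤ 7)
    (hH : HostFarTab 𝓘 τ r Xh) (hTC : TailCert 𝓘 τ Xe)
    (hdom : ∀ (M₀ : ℕ) (z₀ : Fin M₀ → E3) (c₀ h : Fin M₀), Xh M₀ z₀ c₀ h + Xe M₀ z₀ c₀ h ≤ X M₀ z₀ c₀ h)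
    (h0 : HostTop 𝓘 τ bondD3 (cubicTail L) r (k 0 * sigmaOne))
    (hs : ∀ i : ℕ, i < n → HostStep 𝓘 τ sigmaOne bondD3 (cubicTail L) r hessBlk0 force0 X (k i) (k (i + 1) * sigmaOne))
    (hC : SlackCert 𝓘 τ (k n) sigmaOne hessBlk0 force0 X)
    (hF : AnnularPhaseFloor (63 / 10) (24 / 5) (63 / 10) (1 / 1000)) (hP : PolyTextureFloor (63 / 10) (24 / 5) (1 / 1000))
    (hA : AnnularDefectFloor (24 / 5) (63 / 10)) (hD : DefectiveCollarFloor (24 / 5)) : StrainedPatchRec :=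
  strainedPatchRec_of_homFloor_of_tailPenalty_of_coreRelief_of_coreOff_of_annularPhase_of_poly_of_annular_of_near (by norm_num) hHF hT hRl
    seam_arith_core (coreOff_of_gammaTable_tailCert k n hτ hFC hτs hL hsep hr7 hH hTC hdom h0 hs hC) hF hP le_rfl (by norm_num) (by norm_num) hA hD

/-! ## §2 The crux BY NAME from the entry trees and R1″ -/

/-- ★★★ **27623 FROM THE ENTRY TREES AND R1″ (envelope form)** — the record junction with NO cluster-quantified T-side binder: the crux BY NAME from
`UP ∧ 0 ≤ D_X ∧ Eopt-raw ∧ (∃ fcc tree) ∧ (∃ hcp tree) ∧ TailPenalty ∧ CoreCoreRelief ∧ FamilyCover ∧ 2τ < s₀ ∧ HostSep ∧ r + 2τ ≤ 7 ∧ HostFarTab ∧ TailCert ∧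
(Xh + Xe ≤ X) ∧ HostTop ∧ HostStep-table ∧ SlackCert ∧ AnnularPhaseFloor ∧ PolyTextureFloor ∧ AnnularDefectFloor ∧ DefectiveCollarFloor ∧ CC∪T₀ ∧ DD∪T₀`.
[folklore instantiation] -/
theorem aperiodicFrustratedLawGap_of_entryTrees_of_envelope_tailCert {𝓘 : ChartFam} {τ s₀ r : ℝ} {X Xh Xe : SlackTab} {εE CE DE DX : ℝ}
    (k : ℕ → ℝ) (n : ℕ) (hτ : 0 ≤ τ)
    (hε0 : 0 < εE) (hε1 : εE ≤ 1 / 10000) (hU : PeriodicEnergyCeiling (-(7175 / 10000))) (hDX : 0 ≤ DX)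
    (hE : SchurElasticPricingX (1 / 20) (1 / 8) w₄₅ ω₄ (3 / 400) (-(7175 / 10000)) (1 / 10000) CE DE DX (LocOptFails eStar εE (3 / 2) 1))
    (P : ((Fin 3 × Fin 3) ⊕ Fin 3 → ℤ) → ((Fin 3 × Fin 3) ⊕ Fin 3 → ℤ) → HTCert)
    (T : ((Fin 3 × Fin 3) ⊕ Fin 3 → ℤ) → ((Fin 3 × Fin 3) ⊕ Fin 3 → ℤ) → CertTree ((Fin 3 × Fin 3) ⊕ Fin 3))
    (hFcc : ∃ t : CertTree (Fin 3 × Fin 3), treeOK (entryLeafOK6RBKP muRec) t rootC rootW = true)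
    (hHcp : ∃ t : CertTree ((Fin 3 × Fin 3) ⊕ Fin 3), treeOK (entryLeafOKHT5QDMX muRec P T) t rootCH rootWH = true)
    (hT : TailPenalty (24 / 5) (1 / 1000)) (hRl : CoreCoreRelief (63 / 10) (63 / 10) (24 / 5) (1 / 100) (3 / 5000))
    (hFC : FamilyCover 𝓘 (24 / 5) (1 / 100) (1 / 8) τ) (hτs : 2 * τ < s₀) (hsep : HostSep 𝓘 s₀) (hr7 : r + 2 * τ ≤ 7)
    (hH : HostFarTab 𝓘 τ r Xh) (hTC : TailCert 𝓘 τ Xe)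
    (hdom : ∀ (M₀ : ℕ) (z₀ : Fin M₀ → E3) (c₀ h : Fin M₀), Xh M₀ z₀ c₀ h + Xe M₀ z₀ c₀ h ≤ X M₀ z₀ c₀ h)
    (h0 : HostTop 𝓘 τ bondD3 (cubicTail fun s => gammaMaj (s - 2 * τ)) r (k 0 * sigmaOne))
    (hs : ∀ i : ℕ, i < n → HostStep 𝓘 τ sigmaOne bondD3 (cubicTail fun s => gammaMaj (s - 2 * τ)) r hessBlk0 force0 X (k i) (k (i + 1) * sigmaOne))
    (hC : SlackCert 𝓘 τ (k n) sigmaOne hessBlk0 force0 X)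
    (hF : AnnularPhaseFloor (63 / 10) (24 / 5) (63 / 10) (1 / 1000)) (hP : PolyTextureFloor (63 / 10) (24 / 5) (1 / 1000))
    (hA : AnnularDefectFloor (24 / 5) (63 / 10)) (hD : DefectiveCollarFloor (24 / 5))
    (h2 : CrowdedCoreMotifPricingCapK (1 / 1000) (9 / 5) (133 / 10) (3 / 2) (effPot w₄₅ ω₄ (3 / 400)) (-(7175 / 10000) + 3 / 400)
      (Collar (9 / 2) fun N y j => (∃ s : ℝ, 0 ≤ s ∧ s ≤ 3 / 2 ∧ NonEquilibriumCore (-(7175 / 10000)) 0 7 s (1 / 10000) N y j) ∨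
        GoodAtScale (1 / 20) (3 / 2) y j))
    (h3 : DiluteDefectMotifPricingCapK (1 / 1000) (9 / 5) (133 / 10) (3 / 2) (effPot w₄₅ ω₄ (3 / 400)) (-(7175 / 10000) + 3 / 400)
      (Collar (9 / 2) fun N y j => (∃ s : ℝ, 0 ≤ s ∧ s ≤ 3 / 2 ∧ NonEquilibriumCore (-(7175 / 10000)) 0 7 s (1 / 10000) N y j) ∨
        GoodAtScale (1 / 20) (3 / 2) y j)) :
    Summit.AtomisticToContinuum.Crystallization.Theses.FrustratedLawDichotomy.AperiodicFrustratedLawGap :=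
  aperiodicFrustratedLawGap_of_strainedPatchRec hε0 hε1 hU hDX hE
    (strainedPatchRec_of_homFloor_625_of_envelope_tailCert k n hτ (homFloor_625_of_entryTrees6RBKP_HT5QDMX P T hFcc hHcp) hT hRl hFC hτs hsep hr7
      hH hTC hdom h0 hs hC hF hP hA hD) h2 h3

/-- ★★ **Periodic sibling (27624)** of `aperiodicFrustratedLawGap_of_entryTrees_of_envelope_tailCert`. [folklore instantiation] -/
theorem periodicFrustratedLawGap_of_entryTrees_of_envelope_tailCert {𝓘 : ChartFam} {τ s₀ r : ℝ} {X Xh Xe : SlackTab} {εE CE DE DX : ℝ}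
    (k : ℕ → ℝ) (n : ℕ) (hτ : 0 ≤ τ)
    (hε0 : 0 < εE) (hε1 : εE ≤ 1 / 10000) (hU : PeriodicEnergyCeiling (-(7175 / 10000))) (hDX : 0 ≤ DX)
    (hE : SchurElasticPricingX (1 / 20) (1 / 8) w₄₅ ω₄ (3 / 400) (-(7175 / 10000)) (1 / 10000) CE DE DX (LocOptFails eStar εE (3 / 2) 1))
    (P : ((Fin 3 × Fin 3) ⊕ Fin 3 → ℤ) → ((Fin 3 × Fin 3) ⊕ Fin 3 → ℤ) → HTCert)
    (T : ((Fin 3 × Fin 3) ⊕ Fin 3 → ℤ) → ((Fin 3 × Fin 3) ⊕ Fin 3 → ℤ) → CertTree ((Fin 3 × Fin 3) ⊕ Fin 3))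
    (hFcc : ∃ t : CertTree (Fin 3 × Fin 3), treeOK (entryLeafOK6RBKP muRec) t rootC rootW = true)
    (hHcp : ∃ t : CertTree ((Fin 3 × Fin 3) ⊕ Fin 3), treeOK (entryLeafOKHT5QDMX muRec P T) t rootCH rootWH = true)
    (hT : TailPenalty (24 / 5) (1 / 1000)) (hRl : CoreCoreRelief (63 / 10) (63 / 10) (24 / 5) (1 / 100) (3 / 5000))
    (hFC : FamilyCover 𝓘 (24 / 5) (1 / 100) (1 / 8) τ) (hτs : 2 * τ < s₀) (hsep : HostSep 𝓘 s₀) (hr7 : r + 2 * τ ≤ 7)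
    (hH : HostFarTab 𝓘 τ r Xh) (hTC : TailCert 𝓘 τ Xe)
    (hdom : ∀ (M₀ : ℕ) (z₀ : Fin M₀ → E3) (c₀ h : Fin M₀), Xh M₀ z₀ c₀ h + Xe M₀ z₀ c₀ h ≤ X M₀ z₀ c₀ h)
    (h0 : HostTop 𝓘 τ bondD3 (cubicTail fun s => gammaMaj (s - 2 * τ)) r (k 0 * sigmaOne))
    (hs : ∀ i : ℕ, i < n → HostStep 𝓘 τ sigmaOne bondD3 (cubicTail fun s => gammaMaj (s - 2 * τ)) r hessBlk0 force0 X (k i) (k (i + 1) * sigmaOne))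
    (hC : SlackCert 𝓘 τ (k n) sigmaOne hessBlk0 force0 X)
    (hF : AnnularPhaseFloor (63 / 10) (24 / 5) (63 / 10) (1 / 1000)) (hP : PolyTextureFloor (63 / 10) (24 / 5) (1 / 1000))
    (hA : AnnularDefectFloor (24 / 5) (63 / 10)) (hD : DefectiveCollarFloor (24 / 5))
    (h2 : CrowdedCoreMotifPricingCapK (1 / 1000) (9 / 5) (133 / 10) (3 / 2) (effPot w₄₅ ω₄ (3 / 400)) (-(7175 / 10000) + 3 / 400)
      (Collar (9 / 2) fun N y j => (∃ s : ℝ, 0 ≤ s ∧ s ≤ 3 / 2 ∧ NonEquilibriumCore (-(7175 / 10000)) 0 7 s (1 / 10000) N y j) ∨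
        GoodAtScale (1 / 20) (3 / 2) y j))
    (h3 : DiluteDefectMotifPricingCapK (1 / 1000) (9 / 5) (133 / 10) (3 / 2) (effPot w₄₅ ω₄ (3 / 400)) (-(7175 / 10000) + 3 / 400)
      (Collar (9 / 2) fun N y j => (∃ s : ℝ, 0 ≤ s ∧ s ≤ 3 / 2 ∧ NonEquilibriumCore (-(7175 / 10000)) 0 7 s (1 / 10000) N y j) ∨
        GoodAtScale (1 / 20) (3 / 2) y j)) :
    Summit.AtomisticToContinuum.Crystallization.Theses.FrustratedLawDichotomy.PeriodicFrustratedLawGap :=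
  periodicFrustratedLawGap_of_strainedPatchRec hε0 hε1 hU hDX hE
    (strainedPatchRec_of_homFloor_625_of_envelope_tailCert k n hτ (homFloor_625_of_entryTrees6RBKP_HT5QDMX P T hFcc hHcp) hT hRl hFC hτs hsep hr7
      hH hTC hdom h0 hs hC hF hP hA hD) h2 h3

/-- ★★★ **27623 FROM THE ENTRY TREES AND R1″ (census γ-table form)**. [folklore instantiation] -/
theorem aperiodicFrustratedLawGap_of_entryTrees_of_gammaTable_tailCert {𝓘 : ChartFam} {τ s₀ r : ℝ} {L : ℝ → ℝ} {X Xh Xe : SlackTab}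
    {εE CE DE DX : ℝ} (k : ℕ → ℝ) (n : ℕ) (hτ : 0 ≤ τ)
    (hε0 : 0 < εE) (hε1 : εE ≤ 1 / 10000) (hU : PeriodicEnergyCeiling (-(7175 / 10000))) (hDX : 0 ≤ DX)
    (hE : SchurElasticPricingX (1 / 20) (1 / 8) w₄₅ ω₄ (3 / 400) (-(7175 / 10000)) (1 / 10000) CE DE DX (LocOptFails eStar εE (3 / 2) 1))
    (P : ((Fin 3 × Fin 3) ⊕ Fin 3 → ℤ) → ((Fin 3 × Fin 3) ⊕ Fin 3 → ℤ) → HTCert)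
    (T : ((Fin 3 × Fin 3) ⊕ Fin 3 → ℤ) → ((Fin 3 × Fin 3) ⊕ Fin 3 → ℤ) → CertTree ((Fin 3 × Fin 3) ⊕ Fin 3))
    (hFcc : ∃ t : CertTree (Fin 3 × Fin 3), treeOK (entryLeafOK6RBKP muRec) t rootC rootW = true)
    (hHcp : ∃ t : CertTree ((Fin 3 × Fin 3) ⊕ Fin 3), treeOK (entryLeafOKHT5QDMX muRec P T) t rootCH rootWH = true)
    (hT : TailPenalty (24 / 5) (1 / 1000)) (hRl : CoreCoreRelief (63 / 10) (63 / 10) (24 / 5) (1 / 100) (3 / 5000))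
    (hFC : FamilyCover 𝓘 (24 / 5) (1 / 100) (1 / 8) τ) (hτs : 2 * τ < s₀)
    (hL : ∀ s : ℝ, s₀ ≤ s → s < r → ∀ s' : ℝ, |s' - s| ≤ 2 * τ → bondGamma s' ≤ L s) (hsep : HostSep 𝓘 s₀) (hr7 : r + 2 * τ ≤ 7)
    (hH : HostFarTab 𝓘 τ r Xh) (hTC : TailCert 𝓘 τ Xe)
    (hdom : ∀ (M₀ : ℕ) (z₀ : Fin M₀ → E3) (c₀ h : Fin M₀), Xh M₀ z₀ c₀ h + Xe M₀ z₀ c₀ h ≤ X M₀ z₀ c₀ h)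
    (h0 : HostTop 𝓘 τ bondD3 (cubicTail L) r (k 0 * sigmaOne))
    (hs : ∀ i : ℕ, i < n → HostStep 𝓘 τ sigmaOne bondD3 (cubicTail L) r hessBlk0 force0 X (k i) (k (i + 1) * sigmaOne))
    (hC : SlackCert 𝓘 τ (k n) sigmaOne hessBlk0 force0 X)
    (hF : AnnularPhaseFloor (63 / 10) (24 / 5) (63 / 10) (1 / 1000)) (hP : PolyTextureFloor (63 / 10) (24 / 5) (1 / 1000))
    (hA : AnnularDefectFloor (24 / 5) (63 / 10)) (hD : DefectiveCollarFloor (24 / 5))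
    (h2 : CrowdedCoreMotifPricingCapK (1 / 1000) (9 / 5) (133 / 10) (3 / 2) (effPot w₄₅ ω₄ (3 / 400)) (-(7175 / 10000) + 3 / 400)
      (Collar (9 / 2) fun N y j => (∃ s : ℝ, 0 ≤ s ∧ s ≤ 3 / 2 ∧ NonEquilibriumCore (-(7175 / 10000)) 0 7 s (1 / 10000) N y j) ∨
        GoodAtScale (1 / 20) (3 / 2) y j))
    (h3 : DiluteDefectMotifPricingCapK (1 / 1000) (9 / 5) (133 / 10) (3 / 2) (effPot w₄₅ ω₄ (3 / 400)) (-(7175 / 10000) + 3 / 400)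
      (Collar (9 / 2) fun N y j => (∃ s : ℝ, 0 ≤ s ∧ s ≤ 3 / 2 ∧ NonEquilibriumCore (-(7175 / 10000)) 0 7 s (1 / 10000) N y j) ∨
        GoodAtScale (1 / 20) (3 / 2) y j)) :
    Summit.AtomisticToContinuum.Crystallization.Theses.FrustratedLawDichotomy.AperiodicFrustratedLawGap :=
  aperiodicFrustratedLawGap_of_strainedPatchRec hε0 hε1 hU hDX hE
    (strainedPatchRec_of_homFloor_625_of_gammaTable_tailCert k n hτ (homFloor_625_of_entryTrees6RBKP_HT5QDMX P T hFcc hHcp) hT hRl hFC hτs hL hsep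
      hr7 hH hTC hdom h0 hs hC hF hP hA hD) h2 h3

/-- ★★★ **27623 FROM THE ENTRY TREES (hcp: hand 1's centred-rotated verdict `entryLeafOKHT5QDCRX`) AND R1″ (envelope form)**. [folklore instantiation] -/
theorem aperiodicFrustratedLawGap_of_entryTreesCR_of_envelope_tailCert {𝓘 : ChartFam} {τ s₀ r : ℝ} {X Xh Xe : SlackTab} {εE CE DE DX : ℝ}
    (k : ℕ → ℝ) (n : ℕ) (hτ : 0 ≤ τ)
    (hε0 : 0 < εE) (hε1 : εE ≤ 1 / 10000) (hU : PeriodicEnergyCeiling (-(7175 / 10000))) (hDX : 0 ≤ DX)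
    (hE : SchurElasticPricingX (1 / 20) (1 / 8) w₄₅ ω₄ (3 / 400) (-(7175 / 10000)) (1 / 10000) CE DE DX (LocOptFails eStar εE (3 / 2) 1))
    (P : ((Fin 3 × Fin 3) ⊕ Fin 3 → ℤ) → ((Fin 3 × Fin 3) ⊕ Fin 3 → ℤ) → HTCert)
    (Qf : ((Fin 3 × Fin 3) ⊕ Fin 3 → ℤ) → ((Fin 3 × Fin 3) ⊕ Fin 3 → ℤ) → (Fin 4 → ℤ))
    (T : ((Fin 3 × Fin 3) ⊕ Fin 3 → ℤ) → ((Fin 3 × Fin 3) ⊕ Fin 3 → ℤ) → CertTree ((Fin 3 × Fin 3) ⊕ Fin 3))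
    (hFcc : ∃ t : CertTree (Fin 3 × Fin 3), treeOK (entryLeafOK6RBKP muRec) t rootC rootW = true)
    (hHcp : ∃ t : CertTree ((Fin 3 × Fin 3) ⊕ Fin 3), treeOK (entryLeafOKHT5QDCRX muRec P Qf T) t rootCH rootWH = true)
    (hT : TailPenalty (24 / 5) (1 / 1000)) (hRl : CoreCoreRelief (63 / 10) (63 / 10) (24 / 5) (1 / 100) (3 / 5000))
    (hFC : FamilyCover 𝓘 (24 / 5) (1 / 100) (1 / 8) τ) (hτs : 2 * τ < s₀) (hsep : HostSep 𝓘 s₀) (hr7 : r + 2 * τ ≤ 7)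
    (hH : HostFarTab 𝓘 τ r Xh) (hTC : TailCert 𝓘 τ Xe)
    (hdom : ∀ (M₀ : ℕ) (z₀ : Fin M₀ → E3) (c₀ h : Fin M₀), Xh M₀ z₀ c₀ h + Xe M₀ z₀ c₀ h ≤ X M₀ z₀ c₀ h)
    (h0 : HostTop 𝓘 τ bondD3 (cubicTail fun s => gammaMaj (s - 2 * τ)) r (k 0 * sigmaOne))
    (hs : ∀ i : ℕ, i < n → HostStep 𝓘 τ sigmaOne bondD3 (cubicTail fun s => gammaMaj (s - 2 * τ)) r hessBlk0 force0 X (k i) (k (i + 1) * sigmaOne))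
    (hC : SlackCert 𝓘 τ (k n) sigmaOne hessBlk0 force0 X)
    (hF : AnnularPhaseFloor (63 / 10) (24 / 5) (63 / 10) (1 / 1000)) (hP : PolyTextureFloor (63 / 10) (24 / 5) (1 / 1000))
    (hA : AnnularDefectFloor (24 / 5) (63 / 10)) (hD : DefectiveCollarFloor (24 / 5))
    (h2 : CrowdedCoreMotifPricingCapK (1 / 1000) (9 / 5) (133 / 10) (3 / 2) (effPot w₄₅ ω₄ (3 / 400)) (-(7175 / 10000) + 3 / 400)
      (Collar (9 / 2) fun N y j => (∃ s : ℝ, 0 ≤ s ∧ s ≤ 3 / 2 ∧ NonEquilibriumCore (-(7175 / 10000)) 0 7 s (1 / 10000) N y j) ∨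
        GoodAtScale (1 / 20) (3 / 2) y j))
    (h3 : DiluteDefectMotifPricingCapK (1 / 1000) (9 / 5) (133 / 10) (3 / 2) (effPot w₄₅ ω₄ (3 / 400)) (-(7175 / 10000) + 3 / 400)
      (Collar (9 / 2) fun N y j => (∃ s : ℝ, 0 ≤ s ∧ s ≤ 3 / 2 ∧ NonEquilibriumCore (-(7175 / 10000)) 0 7 s (1 / 10000) N y j) ∨
        GoodAtScale (1 / 20) (3 / 2) y j)) :
    Summit.AtomisticToContinuum.Crystallization.Theses.FrustratedLawDichotomy.AperiodicFrustratedLawGap :=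
  aperiodicFrustratedLawGap_of_strainedPatchRec hε0 hε1 hU hDX hE
    (strainedPatchRec_of_homFloor_625_of_envelope_tailCert k n hτ (homFloor_625_of_entryTrees6RBKP_HT5QDCRX P Qf T hFcc hHcp) hT hRl hFC hτs hsep
      hr7 hH hTC hdom h0 hs hC hF hP hA hD) h2 h3

/-! ## §3 Sanity: the cell width of record `τ = 1/100` -/

/-- At `τ = 1/100` the numeric side conditions of R1″ read `1/50 < s₀` and `r ≤ 349/50` (= `7 − 1/50`). [formal bookkeeping] -/
example {𝓘 : ChartFam} {s₀ r : ℝ} {X Xh Xe : SlackTab} (k : ℕ → ℝ) (n : ℕ)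
    (hHF : HomFloor (1 / 625)) (hT : TailPenalty (24 / 5) (1 / 1000)) (hRl : CoreCoreRelief (63 / 10) (63 / 10) (24 / 5) (1 / 100) (3 / 5000))
    (hFC : FamilyCover 𝓘 (24 / 5) (1 / 100) (1 / 8) (1 / 100)) (hs₀ : 1 / 50 < s₀) (hsep : HostSep 𝓘 s₀) (hr : r ≤ 349 / 50)
    (hH : HostFarTab 𝓘 (1 / 100) r Xh) (hTC : TailCert 𝓘 (1 / 100) Xe)
    (hdom : ∀ (M₀ : ℕ) (z₀ : Fin M₀ → E3) (c₀ h : Fin M₀), Xh M₀ z₀ c₀ h + Xe M₀ z₀ c₀ h ≤ X M₀ z₀ c₀ h)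
    (h0 : HostTop 𝓘 (1 / 100) bondD3 (cubicTail fun s => gammaMaj (s - 2 * (1 / 100))) r (k 0 * sigmaOne))
    (hs : ∀ i : ℕ, i < n →
      HostStep 𝓘 (1 / 100) sigmaOne bondD3 (cubicTail fun s => gammaMaj (s - 2 * (1 / 100))) r hessBlk0 force0 X (k i) (k (i + 1) * sigmaOne))
    (hC : SlackCert 𝓘 (1 / 100) (k n) sigmaOne hessBlk0 force0 X)
    (hF : AnnularPhaseFloor (63 / 10) (24 / 5) (63 / 10) (1 / 1000)) (hP : PolyTextureFloor (63 / 10) (24 / 5) (1 / 1000))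
    (hA : AnnularDefectFloor (24 / 5) (63 / 10)) (hD : DefectiveCollarFloor (24 / 5)) : StrainedPatchRec :=
  strainedPatchRec_of_homFloor_625_of_envelope_tailCert k n (by norm_num) hHF hT hRl hFC (by linarith) hsep (by linarith) hH hTC hdom h0 hs hC hF
    hP hA hD

end Summit.AtomisticToContinuum.Crystallization.Theorems.FrustratedLawDichotomyAperiodicGapRecordJunctionTail

end
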